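import Summits.AtomisticToContinuum.Crystallization.Theses.PalmUnimodularRigidity
import Summits.AtomisticToContinuum.Crystallization.Theorems.MinimiserShells.Negative.LoadBearing
import Summits.AtomisticToContinuum.Crystallization.Theorems.MinimiserShells.Negative.Rootedness
import Literature.Probability.Process.PointStationaryLaw
import Literature.MathematicalPhysics.StatisticalMechanics.RootEnergy
import Literature.MathematicalPhysics.StatisticalMechanics.MuGSC
import Summits.AtomisticToContinuum.Crystallization.Theorems.PalmUnimodularRigidityMinimiserShellsEnergyFloorE

/-!
# Energy floor `e_uni ≥ e*`: route item stmt-AtomisticToContinuum-9229 `UnimodularEnergyLowerBound`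
# (stub `stub_energyFloor`, S2, of line `equilibrium-in-law-surgery` of crux `MinimiserShells`,
# stmt-AtomisticToContinuum-9225)

**Theorem** (`stub_energyFloor : UnimodularEnergyLowerBound`).  For every `δ > 0` and every
probability law `P` on configurations of `ℝ³` which is almost surely a rooted `δ`-hard-core
counting measure and satisfies the Mecke / mass-transport identity (`IsPointStationaryLaw`),
`e* = ⨅_Q e_LJ(Q) ≤ E_P[h]`, `h(μ) = ½ ∫ V_LJ(‖y‖) dμ` (`meanRootEnergy`).

**Proof** (random-grid mass transport; definitions in `…EnergyFloorDefs`, lemmas in parts A–E):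
1. (part D/E) With the transport `g = transport δ L` ("the root sends `(local energy + C_δ)/#cell`
   to every point of its own cell of the grid `L(v + ℤ³ + [0,1)³)`, averaged over the phase
   `v ∈ [0,1)³`"), Mecke gives `E_P[IN] = E_P[OUT]`, where almost surely
   `OUT = ∫_{[0,1)³} ofReal (locEnergy + C_δ) dv` and `IN ≥ vol · ofReal (e* + C_δ)` (periodisation
   of the root's cluster, `card_mul_eStar_le`) — `volume_mul_ofReal_le_lintegral_locEnergy`.
2. (boundary error) `locEnergy ≤ h' + (1/12) ∑_{z outside the root's cell} ‖z‖⁻⁶`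
   (`V_LJ ≥ -r⁻⁶/6`), so the phase average of `ofReal (locEnergy + C_δ)` is at most
   `vol · ofReal (h' + C_δ) + err_L/12`, `err_L(μ) = ∑_z ‖z‖⁻⁶ · vol{v | z ∉ rootCell L v}`
   (`setLIntegral_ofReal_locEnergy_le`); `err_L ≤ 250 δ⁻⁶ vol` and `err_L(μ) → 0` as `L → ∞`
   for every hard-core `μ` (`phaseOut L z → 0`, dominated convergence twice).
3. Letting `L = n + 1 → ∞`: `ofReal (e* + C_δ) ≤ E_P[ofReal (h' + C_δ)]` (`ofReal_eStar_add_le`),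
   and `h'` (the measurable root energy of part C) is the Bochner `h` on hard-core configurations,
   bounded, hence `E_P[ofReal (h' + C_δ)] = ofReal (E_P[h] + C_δ)`; strip `ofReal`.
-/


noncomputable section

open MeasureTheory
open scoped ENNReal BigOperators

namespace Summit.AtomisticToContinuum.Crystallization.Theorems.PalmUnimodularRigidityMinimiserShells.EnergyFloor

open Literature.Probability.Process (IsPointStationaryLaw IsRootedHardCore count_restrict_singleton_ne_zero_iff
  map_sub_count_restrict)
open Literature.MathematicalPhysics.StatisticalMechanics (lennardJones IsMuGSC UniformlyDiscrete)
open Summit.AtomisticToContinuum.Crystallization.Theses.PalmUnimodularRigidity (MinimiserShells UnimodularEnergyLowerBound)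
open Summit.AtomisticToContinuum.Crystallization.Theorems.MinimiserShells.Negative.LoadBearing
  (eStar meanRootEnergy GoodShell minimiserShells_iff)
open Summit.AtomisticToContinuum.Crystallization.Theorems.MinimiserShells.Negative.Rootedness
  (countable_of_separated)
open Filter
open scoped Topology

/-! ## The boundary error, the limit `L → ∞`, and the energy floor -/

section Floor

open Summit.AtomisticToContinuum.Crystallization.Theorems.MinimiserShells.Negative.Rootedness
  (unimodularEnergyLowerBound_iff)

variable {δ L : ℝ}

/-- **Mecke for the random-grid transport**: for a point-stationary `δ`-hard-core probability law,
`vol([0,1)³) · (e* + C_δ) ≤ E_P[ phase average of (local energy + C_δ) ]`. -/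
theorem volume_mul_ofReal_le_lintegral_locEnergy (hδ : 0 < δ) (hL : 0 < L)
    (P : Measure (Measure (EuclideanSpace ℝ (Fin 3)))) [IsProbabilityMeasure P]
    (hcore : ∀ᵐ μ ∂P, IsRootedHardCore δ μ) (hstat : IsPointStationaryLaw P) :
    volume phaseDom * ENNReal.ofReal (eStar + cst δ) ≤
      ∫⁻ μ, (∫⁻ v in phaseDom, ENNReal.ofReal (locEnergy δ μ (rootCell L v) + cst δ)) ∂P := by
  have hM := hstat (transport δ L) (measurable_transport δ L)
  calc volume phaseDom * ENNReal.ofReal (eStar + cst δ)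
      = ∫⁻ _, volume phaseDom * ENNReal.ofReal (eStar + cst δ) ∂P := by
        rw [lintegral_const, measure_univ, mul_one]
    _ ≤ ∫⁻ μ, (∫⁻ y, transport δ L (μ.map fun z => z - y) (-y) ∂μ) ∂P :=
        lintegral_mono_ae (hcore.mono fun μ hμ => le_lintegral_transport_map hδ hL hμ)
    _ = ∫⁻ μ, (∫⁻ y, transport δ L μ y ∂μ) ∂P := hM.symm
    _ = ∫⁻ μ, (∫⁻ v in phaseDom, ENNReal.ofReal (locEnergy δ μ (rootCell L v) + cst δ)) ∂P :=
        lintegral_congr_ae (hcore.mono fun μ hμ => lintegral_transport_eq hδ hL hμ)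

/-- **Boundary error at a fixed phase**: the local energy exceeds the root energy by at most a
twelfth of the `‖z‖⁻⁶`-sum over the points OUTSIDE the root's cell (`V_LJ ≥ -r⁻⁶/6`). -/
theorem ofReal_locEnergy_le (hδ : 0 < δ) {μ : Measure (EuclideanSpace ℝ (Fin 3))}
    (hμ : IsRootedHardCore δ μ) (L : ℝ) (v : EuclideanSpace ℝ (Fin 3)) :
    ENNReal.ofReal (locEnergy δ μ (rootCell L v) + cst δ) ≤
      ENNReal.ofReal (rootEnergy' μ + cst δ) +
        ENNReal.ofReal (1 / 12) * ∫⁻ z in (rootCell L v)ᶜ, ENNReal.ofReal (‖z‖⁻¹ ^ 6) ∂μ := by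
  have hmem := mem_hcClass_of_hc hδ hμ
  have hR := measurableSet_rootCell L v
  set gp : EuclideanSpace ℝ (Fin 3) → ℝ≥0∞ := fun z => ENNReal.ofReal (lennardJones ‖z‖) with hgp
  set gn : EuclideanSpace ℝ (Fin 3) → ℝ≥0∞ := fun z => ENNReal.ofReal (-lennardJones ‖z‖) with hgn
  set g6 : EuclideanSpace ℝ (Fin 3) → ℝ≥0∞ := fun z => ENNReal.ofReal (‖z‖⁻¹ ^ 6) with hg6
  -- the four pieces and their finiteness
  have hPtop : ∫⁻ z, gp z ∂μ ≠ ∞ := lintegral_pos_ne_top_of_hc hδ hμ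
  have hNtop : ∫⁻ z, gn z ∂μ ≠ ∞ :=
    ((lintegral_neg_le_of_hc hδ hμ).trans_lt ENNReal.ofReal_lt_top).ne
  have hPsplit := lintegral_add_compl gp hR (μ := μ)
  have hNsplit := lintegral_add_compl gn hR (μ := μ)
  have hPin : (∫⁻ z in rootCell L v, gp z ∂μ) ≠ ∞ := ne_top_of_le_ne_top hPtop (by rw [← hPsplit]; exact le_self_add)
  have hPout : (∫⁻ z in (rootCell L v)ᶜ, gp z ∂μ) ≠ ∞ := ne_top_of_le_ne_top hPtop (by rw [← hPsplit]; exact le_add_self)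
  have hNin : (∫⁻ z in rootCell L v, gn z ∂μ) ≠ ∞ := ne_top_of_le_ne_top hNtop (by rw [← hNsplit]; exact le_self_add)
  have hNout : (∫⁻ z in (rootCell L v)ᶜ, gn z ∂μ) ≠ ∞ := ne_top_of_le_ne_top hNtop (by rw [← hNsplit]; exact le_add_self)
  -- the local energy and the root energy through the pieces
  have hloc : locEnergy δ μ (rootCell L v) =
      ((∫⁻ z in rootCell L v, gp z ∂μ).toReal - (∫⁻ z in rootCell L v, gn z ∂μ).toReal) / 2 := by
    unfold locEnergy locPos locNeg
    rw [trunc_of_mem hmem, lintegral_indicator hR, lintegral_indicator hR]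
  have hroot : rootEnergy' μ =
      ((∫⁻ z in rootCell L v, gp z ∂μ).toReal + (∫⁻ z in (rootCell L v)ᶜ, gp z ∂μ).toReal -
        ((∫⁻ z in rootCell L v, gn z ∂μ).toReal + (∫⁻ z in (rootCell L v)ᶜ, gn z ∂μ).toReal)) / 2 := by
    unfold rootEnergy'
    rw [← hPsplit, ← hNsplit, ENNReal.toReal_add hPin hPout, ENNReal.toReal_add hNin hNout]
  -- the negative part outside is controlled by the `‖z‖⁻⁶`-sum outside
  have hout : (∫⁻ z in (rootCell L v)ᶜ, gn z ∂μ) ≤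
      ENNReal.ofReal (1 / 6) * ∫⁻ z in (rootCell L v)ᶜ, g6 z ∂μ := by
    rw [← lintegral_const_mul _ measurable_ofReal_inv_norm_pow_six]
    refine lintegral_mono fun z => ?_
    show ENNReal.ofReal (-lennardJones ‖z‖) ≤ ENNReal.ofReal (1 / 6) * ENNReal.ofReal (‖z‖⁻¹ ^ 6)
    rw [← ENNReal.ofReal_mul (by norm_num)]
    exact ENNReal.ofReal_le_ofReal (neg_lennardJones_le _)
  have h6top : (∫⁻ z in (rootCell L v)ᶜ, g6 z ∂μ) ≠ ∞ :=
    ne_top_of_le_ne_top ((lintegral_inv_six_le_of_hc hδ hμ).trans_lt ENNReal.ofReal_lt_top).ne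
      (lintegral_mono' Measure.restrict_le_self le_rfl)
  have hout' : (∫⁻ z in (rootCell L v)ᶜ, gn z ∂μ).toReal ≤
      1 / 6 * (∫⁻ z in (rootCell L v)ᶜ, g6 z ∂μ).toReal := by
    have := ENNReal.toReal_mono (ENNReal.mul_ne_top ENNReal.ofReal_ne_top h6top) hout
    rwa [ENNReal.toReal_mul, ENNReal.toReal_ofReal (by norm_num)] at this
  have hpos0 : 0 ≤ (∫⁻ z in (rootCell L v)ᶜ, gp z ∂μ).toReal := ENNReal.toReal_nonneg
  -- real inequality
  have hreal : locEnergy δ μ (rootCell L v) + cst δ ≤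
      (rootEnergy' μ + cst δ) + 1 / 12 * (∫⁻ z in (rootCell L v)ᶜ, g6 z ∂μ).toReal := by
    rw [hloc, hroot]
    linarith
  calc ENNReal.ofReal (locEnergy δ μ (rootCell L v) + cst δ)
      ≤ ENNReal.ofReal ((rootEnergy' μ + cst δ) + 1 / 12 * (∫⁻ z in (rootCell L v)ᶜ, g6 z ∂μ).toReal) :=
        ENNReal.ofReal_le_ofReal hreal
    _ ≤ ENNReal.ofReal (rootEnergy' μ + cst δ) +
          ENNReal.ofReal (1 / 12 * (∫⁻ z in (rootCell L v)ᶜ, g6 z ∂μ).toReal) := ENNReal.ofReal_add_le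
    _ ≤ ENNReal.ofReal (rootEnergy' μ + cst δ) +
          ENNReal.ofReal (1 / 12) * ∫⁻ z in (rootCell L v)ᶜ, g6 z ∂μ := by
        gcongr
        rw [ENNReal.ofReal_mul (by norm_num)]
        gcongr
        exact ENNReal.ofReal_toReal_le

/-- `err_L` is Giry-measurable. -/
theorem measurable_errTerm (L : ℝ) : Measurable (errTerm L) :=
  Measure.measurable_lintegral (measurable_ofReal_inv_norm_pow_six.mul (measurable_phaseOut L))

/-- `err_L ≤ 250 δ⁻⁶ · vol([0,1)³)` on rooted hard-core configurations. -/
theorem errTerm_le (hδ : 0 < δ) {μ : Measure (EuclideanSpace ℝ (Fin 3))} (hμ : IsRootedHardCore δ μ)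
    (L : ℝ) : errTerm L μ ≤ ENNReal.ofReal (250 * δ⁻¹ ^ 6) * volume phaseDom := by
  unfold errTerm
  calc ∫⁻ z, ENNReal.ofReal (‖z‖⁻¹ ^ 6) * phaseOut L z ∂μ
      ≤ ∫⁻ z, ENNReal.ofReal (‖z‖⁻¹ ^ 6) * volume phaseDom ∂μ :=
        lintegral_mono fun z => mul_le_mul' le_rfl (phaseOut_le L z)
    _ = (∫⁻ z, ENNReal.ofReal (‖z‖⁻¹ ^ 6) ∂μ) * volume phaseDom :=
        lintegral_mul_const _ measurable_ofReal_inv_norm_pow_six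
    _ ≤ ENNReal.ofReal (250 * δ⁻¹ ^ 6) * volume phaseDom :=
        mul_le_mul' (lintegral_inv_six_le_of_hc hδ hμ) le_rfl

/-- **`err_L → 0` as `L → ∞`** on each rooted hard-core configuration (dominated convergence over
the configuration, `phaseOut L z → 0` pointwise). -/
theorem tendsto_errTerm (hδ : 0 < δ) {μ : Measure (EuclideanSpace ℝ (Fin 3))} (hμ : IsRootedHardCore δ μ)
    {Ls : ℕ → ℝ} (hLs : Tendsto Ls atTop atTop) :
    Tendsto (fun n => errTerm (Ls n) μ) atTop (𝓝 0) := by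
  unfold errTerm
  have hlim : ∫⁻ _z, (0 : ℝ≥0∞) ∂μ = 0 := lintegral_zero
  rw [← hlim]
  refine tendsto_lintegral_of_dominated_convergence
    (fun z => ENNReal.ofReal (‖z‖⁻¹ ^ 6) * volume phaseDom)
    (fun n => measurable_ofReal_inv_norm_pow_six.mul (measurable_phaseOut _))
    (fun n => Eventually.of_forall fun z => mul_le_mul' le_rfl (phaseOut_le _ z)) ?_ ?_
  · rw [lintegral_mul_const _ measurable_ofReal_inv_norm_pow_six]
    exact ENNReal.mul_ne_top
      ((lintegral_inv_six_le_of_hc hδ hμ).trans_lt ENNReal.ofReal_lt_top).ne volume_phaseDom_ne_top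
  · refine Eventually.of_forall fun z => ?_
    have h := ENNReal.Tendsto.const_mul (tendsto_phaseOut hLs z) (Or.inr ENNReal.ofReal_ne_top)
      (a := ENNReal.ofReal (‖z‖⁻¹ ^ 6))
    rwa [mul_zero] at h

/-- **Averaged boundary error**: the phase average of `(local energy + C_δ)` is at most
`vol([0,1)³) · (root energy + C_δ) + err_L / 12`. -/
theorem setLIntegral_ofReal_locEnergy_le (hδ : 0 < δ) (L : ℝ) {μ : Measure (EuclideanSpace ℝ (Fin 3))}
    (hμ : IsRootedHardCore δ μ) :
    ∫⁻ v in phaseDom, ENNReal.ofReal (locEnergy δ μ (rootCell L v) + cst δ) ≤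
      volume phaseDom * ENNReal.ofReal (rootEnergy' μ + cst δ) + ENNReal.ofReal (1 / 12) * errTerm L μ := by
  have hμ' := hμ
  obtain ⟨S, h0, hsep, rfl⟩ := hμ
  have hS := countable_of_separated hδ hsep
  -- the outside sum as a function of (z, v)
  have hind : ∀ z v : EuclideanSpace ℝ (Fin 3), (rootCell L v)ᶜ.indicator (fun z => ENNReal.ofReal (‖z‖⁻¹ ^ 6)) z =
      {v : EuclideanSpace ℝ (Fin 3) | cellIdx L v z ≠ cellIdx L v 0}.indicator
        (fun _ => ENNReal.ofReal (‖z‖⁻¹ ^ 6)) v := by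
    intro z v
    by_cases hz : cellIdx L v z = cellIdx L v 0
    · rw [Set.indicator_of_notMem (fun h : z ∈ (rootCell L v)ᶜ => h hz),
        Set.indicator_of_notMem (fun h : v ∈ {v : EuclideanSpace ℝ (Fin 3) |
          cellIdx L v z ≠ cellIdx L v 0} => h hz)]
    · rw [Set.indicator_of_mem (show z ∈ (rootCell L v)ᶜ from hz),
        Set.indicator_of_mem (show v ∈ {v : EuclideanSpace ℝ (Fin 3) |
          cellIdx L v z ≠ cellIdx L v 0} from hz)]
  have hswap : ∫⁻ v in phaseDom, (∫⁻ z in (rootCell L v)ᶜ, ENNReal.ofReal (‖z‖⁻¹ ^ 6)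
      ∂((Measure.count : Measure (EuclideanSpace ℝ (Fin 3))).restrict S)) =
      errTerm L ((Measure.count : Measure (EuclideanSpace ℝ (Fin 3))).restrict S) := by
    unfold errTerm phaseOut
    have h1 : ∀ v, (∫⁻ z in (rootCell L v)ᶜ, ENNReal.ofReal (‖z‖⁻¹ ^ 6)
        ∂((Measure.count : Measure (EuclideanSpace ℝ (Fin 3))).restrict S)) =
        ∫⁻ z, {v : EuclideanSpace ℝ (Fin 3) | cellIdx L v z ≠ cellIdx L v 0}.indicator
          (fun _ => ENNReal.ofReal (‖z‖⁻¹ ^ 6)) v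
          ∂((Measure.count : Measure (EuclideanSpace ℝ (Fin 3))).restrict S) := by
      intro v
      rw [← lintegral_indicator (measurableSet_rootCell L v).compl]
      exact lintegral_congr fun z => hind z v
    simp_rw [h1]
    rw [← lintegral_count_restrict_setLIntegral_comm hS
      (F := fun z v => {v : EuclideanSpace ℝ (Fin 3) | cellIdx L v z ≠ cellIdx L v 0}.indicator
        (fun _ => ENNReal.ofReal (‖z‖⁻¹ ^ 6)) v)
      (fun z => measurable_const.indicator (measurableSet_setOf_cellIdx_eq_phase L z 0).compl)
      phaseDom]
    refine lintegral_congr fun z => ?_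
    have hs : MeasurableSet {v : EuclideanSpace ℝ (Fin 3) | cellIdx L v z ≠ cellIdx L v 0} :=
      (measurableSet_setOf_cellIdx_eq_phase L z 0).compl
    rw [lintegral_indicator_const hs]
  calc ∫⁻ v in phaseDom, ENNReal.ofReal (locEnergy δ ((Measure.count : Measure (EuclideanSpace ℝ (Fin 3))).restrict S)
        (rootCell L v) + cst δ)
      ≤ ∫⁻ v in phaseDom, (ENNReal.ofReal (rootEnergy' ((Measure.count : Measure (EuclideanSpace ℝ (Fin 3))).restrict S) + cst δ) +
          ENNReal.ofReal (1 / 12) * ∫⁻ z in (rootCell L v)ᶜ, ENNReal.ofReal (‖z‖⁻¹ ^ 6)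
            ∂((Measure.count : Measure (EuclideanSpace ℝ (Fin 3))).restrict S)) :=
        lintegral_mono fun v => ofReal_locEnergy_le hδ hμ' L v
    _ = volume phaseDom * ENNReal.ofReal (rootEnergy' ((Measure.count : Measure (EuclideanSpace ℝ (Fin 3))).restrict S) + cst δ) +
          ENNReal.ofReal (1 / 12) * errTerm L ((Measure.count : Measure (EuclideanSpace ℝ (Fin 3))).restrict S) := by
        rw [lintegral_add_left measurable_const, setLIntegral_const, mul_comm, ← hswap,
          lintegral_const_mul']
        exact ENNReal.ofReal_ne_top

/-- **The energy floor in `lintegral` form**: `e* + C_δ ≤ E_P[h' + C_δ]` for every point-stationary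
`δ`-hard-core probability law (`h'` the measurable root energy). -/
theorem ofReal_eStar_add_le (hδ : 0 < δ) (P : Measure (Measure (EuclideanSpace ℝ (Fin 3))))
    [IsProbabilityMeasure P] (hcore : ∀ᵐ μ ∂P, IsRootedHardCore δ μ) (hstat : IsPointStationaryLaw P) :
    ENNReal.ofReal (eStar + cst δ) ≤ ∫⁻ μ, ENNReal.ofReal (rootEnergy' μ + cst δ) ∂P := by
  set D : ℝ≥0∞ := volume phaseDom with hD
  set I : ℝ≥0∞ := ∫⁻ μ, ENNReal.ofReal (rootEnergy' μ + cst δ) ∂P with hI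
  set e : ℕ → ℝ≥0∞ := fun n => ∫⁻ μ, errTerm ((n : ℝ) + 1) μ ∂P with he
  have hmeasI : Measurable fun μ : Measure (EuclideanSpace ℝ (Fin 3)) =>
      ENNReal.ofReal (rootEnergy' μ + cst δ) :=
    ENNReal.measurable_ofReal.comp (measurable_rootEnergy'.add_const _)
  have hstep : ∀ n : ℕ, D * ENNReal.ofReal (eStar + cst δ) ≤ D * I + ENNReal.ofReal (1 / 12) * e n := by
    intro n
    have hL : (0 : ℝ) < n + 1 := by positivity
    calc D * ENNReal.ofReal (eStar + cst δ)
        ≤ ∫⁻ μ, (∫⁻ v in phaseDom, ENNReal.ofReal (locEnergy δ μ (rootCell ((n : ℝ) + 1) v) + cst δ)) ∂P :=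
          volume_mul_ofReal_le_lintegral_locEnergy hδ hL P hcore hstat
      _ ≤ ∫⁻ μ, (D * ENNReal.ofReal (rootEnergy' μ + cst δ) +
            ENNReal.ofReal (1 / 12) * errTerm ((n : ℝ) + 1) μ) ∂P :=
          lintegral_mono_ae (hcore.mono fun μ hμ => setLIntegral_ofReal_locEnergy_le hδ _ hμ)
      _ = D * I + ENNReal.ofReal (1 / 12) * e n := by
          rw [lintegral_add_left (hmeasI.const_mul _), lintegral_const_mul _ hmeasI,
            lintegral_const_mul _ (measurable_errTerm _)]
  have hlim : Tendsto e atTop (𝓝 0) := by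
    have hLs : Tendsto (fun n : ℕ => (n : ℝ) + 1) atTop atTop :=
      tendsto_atTop_add_const_right _ _ tendsto_natCast_atTop_atTop
    have h := tendsto_lintegral_of_dominated_convergence (μ := P)
      (F := fun n μ => errTerm ((n : ℝ) + 1) μ) (f := fun _ => 0)
      (fun _ => ENNReal.ofReal (250 * δ⁻¹ ^ 6) * D) (fun n => measurable_errTerm _)
      (fun n => hcore.mono fun μ hμ => errTerm_le hδ hμ _)
      (by
        rw [lintegral_const, measure_univ, mul_one]
        exact ENNReal.mul_ne_top ENNReal.ofReal_ne_top volume_phaseDom_ne_top)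
      (hcore.mono fun μ hμ => tendsto_errTerm hδ hμ hLs)
    simpa using h
  have hfin : D * ENNReal.ofReal (eStar + cst δ) ≤ D * I := by
    have ht : Tendsto (fun n => D * I + ENNReal.ofReal (1 / 12) * e n) atTop
        (𝓝 (D * I + ENNReal.ofReal (1 / 12) * 0)) :=
      tendsto_const_nhds.add (ENNReal.Tendsto.const_mul hlim (Or.inr ENNReal.ofReal_ne_top))
    rw [mul_zero, add_zero] at ht
    exact ge_of_tendsto' ht hstep
  exact (ENNReal.mul_le_mul_iff_right volume_phaseDom_ne_zero volume_phaseDom_ne_top).1 hfin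

/-- **stub_energyFloor** (S2 = DISCHARGE of route item stmt-AtomisticToContinuum-9229
`UnimodularEnergyLowerBound`, "e_uni ≥ e*"): every point-stationary `δ`-hard-core probability law
on rooted configurations of `ℝ³` has mean root energy `E_P[h] ≥ e* = ⨅_Q e_LJ(Q)`.  Proof: the
random-grid mass transport (`transport`): OUT = phase average of local energy
(`lintegral_transport_eq`), IN ≥ `e* + C_δ` by periodisation of the root's cluster
(`le_lintegral_transport_map`, `card_mul_eStar_le`), Mecke identity, boundary error `err_L/12 → 0`
as the mesh `L → ∞` (dominated convergence), and the identification of the measurable root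
energy with the Bochner one on hard-core configurations. -/
theorem stub_energyFloor : UnimodularEnergyLowerBound := by
  rw [unimodularEnergyLowerBound_iff]
  intro δ hδ P hP hcore hstat
  have hbounds : ∀ᵐ μ ∂P, 0 ≤ rootEnergy' μ + cst δ ∧ rootEnergy' μ + cst δ ≤ cst δ + 250 / 24 * δ⁻¹ ^ 12 :=
    hcore.mono fun μ hμ => by
      obtain ⟨h1, h2⟩ := rootEnergy'_bounds_of_hc hδ hμ
      unfold cst
      constructor <;> linarith
  have hC0 : 0 ≤ cst δ := cst_nonneg δ
  have hK0 : (0 : ℝ) ≤ 250 / 24 * δ⁻¹ ^ 12 := by positivity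
  have hint' : Integrable rootEnergy' P := by
    refine Integrable.of_bound measurable_rootEnergy'.aestronglyMeasurable
      (cst δ + 250 / 24 * δ⁻¹ ^ 12) (hbounds.mono fun μ hμ => ?_)
    rw [Real.norm_eq_abs, abs_le]
    constructor <;> linarith [hμ.1, hμ.2]
  have hint : Integrable (fun μ => rootEnergy' μ + cst δ) P := hint'.add (integrable_const _)
  have hnn : 0 ≤ᵐ[P] fun μ => rootEnergy' μ + cst δ := hbounds.mono fun μ hμ => hμ.1
  have hmain := ofReal_eStar_add_le hδ P hcore hstat
  rw [← ofReal_integral_eq_lintegral_ofReal hint hnn] at hmain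
  have hae : (fun μ : Measure (EuclideanSpace ℝ (Fin 3)) => (∫ y, lennardJones ‖y‖ ∂μ) / 2) =ᵐ[P]
      rootEnergy' := hcore.mono fun μ hμ => (rootEnergy'_eq_of_hc hδ hμ).symm
  have hI : ∫ μ, (rootEnergy' μ + cst δ) ∂P = meanRootEnergy P + cst δ := by
    rw [integral_add hint' (integrable_const _), integral_const, probReal_univ, one_smul]
    unfold meanRootEnergy
    rw [integral_congr_ae hae]
  have h0 : 0 ≤ meanRootEnergy P + cst δ := by
    rw [← hI]
    exact integral_nonneg_of_ae hnn
  rw [hI] at hmain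
  have := (ENNReal.ofReal_le_ofReal_iff h0).1 hmain
  linarith

end Floor

end Summit.AtomisticToContinuum.Crystallization.Theorems.PalmUnimodularRigidityMinimiserShells.EnergyFloor

end
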